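import Literature.Geometry.Kaehler.ComplexTorusIntegralHardLefschetzCokernelExponents
import HarnessLib

/-!
# Hard Lefschetz with the minimal classes modulo `N`: `γ_{g−1} ∧ H¹(X, ℤ) + N·H^{2g−1}(X, ℤ) = H^{2g−1}(X, ℤ) ⟺ gcd(N, d_g/d₁) = 1`,
# `γ_{g−2} ∧ H³(X, ℤ) + N·H^{2g−1}(X, ℤ) = H^{2g−1}(X, ℤ) ⟺ gcd(N, d_{g−1}/d₁) = 1`

Layer `Literature/Geometry/Kaehler`, namespace `Literature.Geometry.Kaehler.ComplexTorus`; lane `lit-hodgefound` (Track 2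
foundations library), seat p09, generation 41, row g41-#8. THEOREMS ONLY (0 definitions); no named fact, net debt 0. Sequel of
g41-#5 `ComplexTorusIntegralHardLefschetzCokernelExponents` (the torsion exponents `d_g/d₁`, `d_{g−1}/d₁` of the hard-Lefschetz cokernels)
and g40-#5 `ComplexTorusIntegralCoLefschetzMinimalClassCokernels` (the cokernels as `⊕ ℤ/(d_g/d_a)`); the degree-two, constant-type case
(`γ_{g−2} ∧ H² + N·H^{2g−2} = H^{2g−2} ⟺ gcd(N, g−1) = 1`) is g41-#2 `ComplexTorusHardLefschetzMinimalClassModPrimeKernel`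
(`…sup_map_nsmul_eq_iff_coprime_of_forall_eq`).

Sources (the statements being made precise over `ℤ`):

* Lange 2023 §5.4.1 Thm. 5.4.1 and (5.22) (PDF p. 275: hard Lefschetz over `ℂ`), §2.5.3 Thm. 2.5.16 / Cor. 2.5.17 (PDF p. 135), §1.5.1 (PDF p. 51);
* Voisin 2002 §7.1.2 (PDF p. 134 L31: `L` acts on `H•(X, ℤ)`; hard Lefschetz is a statement with rational — not integral — coefficients),
  §7.2.2 (PDF p. 142 L10);
* Adkins–Weintraub 1992 Ch. 3 §7 Thm. (7.1) / Rem. (7.10) (exponent of a finite abelian group = last invariant factor).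

THE POINT. For a subgroup `S ≤ H` with finite quotient `Q = H/S` of exponent `e`: `S + N·H = H` iff multiplication by `N` is onto `Q` iff it is
bijective iff `gcd(N, e) = 1` (if a prime `p ∣ gcd(N, e)`, the element `(e/p)·x ≠ 0` given by minimality of the exponent is killed by `p`, hence
by `N`; conversely `aN + be = 1` gives `q = N·(a q)`). With g41-#5 (`e = d_g/d₁`, resp. `d_{g−1}/d₁`):

  **`γ_{g−1} ∧ H¹(X, ℤ) + N·H^{2g−1}(X, ℤ) = H^{2g−1}(X, ℤ) ⟺ gcd(N, d_g/d₁) = 1`**, in particular for a prime `p`: the minimal class induces a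
  surjection (equivalently, counting ranks, an isomorphism) `H¹(X, ℤ/p) → H^{2g−1}(X, ℤ/p)` iff `p ∤ d_g/d₁`;
  **`γ_{g−2} ∧ H³(X, ℤ) + N·H^{2g−1}(X, ℤ) = H^{2g−1}(X, ℤ) ⟺ gcd(N, d_{g−1}/d₁) = 1`**.

## Contents (theorems only; `g = j + 2`)

* §0 (private) `S + N·H = H ⟺ N· onto H/S ⟺ gcd(N, exponent) = 1` for a finite sub-quotient.
* §1 degree one: `IsSymplecticEnum.map_wedge_integralForms_one_sup_map_nsmul_eq_iff_coprime_of_eq_content_smul`, prime form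
  `…_iff_not_dvd_…`.
* §2 the co-Lefschetz map on `H³`: `IsSymplecticEnum.map_wedge_integralForms_three_sup_map_nsmul_eq_iff_coprime_of_eq_content_smul`, prime form.
* §3 basis-free (`IsPolarizationType`) forms and existence forms.

## References

* [cite: Lange2023AbelianVarietiesComplex, §5.4.1 Thm. 5.4.1 and (5.22) (PDF p. 275); §2.5.3 Thm. 2.5.16 and Cor. 2.5.17 (PDF p. 135); §1.5.1 (PDF p. 51)]
* [cite: VoisinHodgeI2002, §7.1.2 (PDF p. 134 L31); §7.2.2 (PDF p. 142 L10)]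
* [cite: AdkinsWeintraub1992, Ch. 3 §7 Thm. (7.1) and Rem. (7.10)]
-/

noncomputable section

open Module Function
open Literature.LinearAlgebra.Alternating

namespace Literature.Geometry.Kaehler.ComplexTorus

/-! ## §0 `S + N·H = H ⟺ gcd(N, exponent(H/S)) = 1` (private) -/

section Generic

variable {G : Type*} [AddCommGroup G] {H S : AddSubgroup G}

/-- `S + N·H = H` iff multiplication by `N` is onto `H/(S ∩ H)` (`S ≤ H`). [cite: AdkinsWeintraub1992, Ch. 3 §7 Thm. (7.1)] -/
private theorem sup_map_nsmul_eq_iff_nsmul_surjective₄₉ (hSH : S ≤ H) (N : ℕ) :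
    S ⊔ H.map (nsmulAddMonoidHom N) = H ↔ Surjective (fun q : ↥H ⧸ S.addSubgroupOf H ↦ N • q) := by
  constructor
  · intro hsup q
    obtain ⟨⟨y, hy⟩, rfl⟩ := QuotientAddGroup.mk_surjective q
    have hy' : y ∈ S ⊔ H.map (nsmulAddMonoidHom N) := hsup.symm ▸ hy
    obtain ⟨s, hs, _, ⟨h, hh, rfl⟩, hsum⟩ := AddSubgroup.mem_sup.1 hy'
    refine ⟨QuotientAddGroup.mk ⟨h, hh⟩, ?_⟩
    change N • (QuotientAddGroup.mk ⟨h, hh⟩ : ↥H ⧸ S.addSubgroupOf H) = QuotientAddGroup.mk ⟨y, hy⟩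
    rw [← QuotientAddGroup.mk_nsmul, QuotientAddGroup.eq_iff_sub_mem, AddSubgroup.mem_addSubgroupOf]
    change N • h - y ∈ S
    rw [nsmulAddMonoidHom_apply] at hsum
    rw [← hsum, sub_add_cancel_right]
    exact S.neg_mem hs
  · intro hsurj
    refine le_antisymm (sup_le hSH ?_) fun y hy ↦ ?_
    · rintro _ ⟨h, hh, rfl⟩
      exact H.nsmul_mem hh N
    · obtain ⟨q', hq'⟩ := hsurj (QuotientAddGroup.mk ⟨y, hy⟩)
      obtain ⟨⟨h, hh⟩, rfl⟩ := QuotientAddGroup.mk_surjective q'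
      change N • (QuotientAddGroup.mk ⟨h, hh⟩ : ↥H ⧸ S.addSubgroupOf H) = QuotientAddGroup.mk ⟨y, hy⟩ at hq'
      rw [← QuotientAddGroup.mk_nsmul, QuotientAddGroup.eq_iff_sub_mem, AddSubgroup.mem_addSubgroupOf] at hq'
      change N • h - y ∈ S at hq'
      have : y = -(N • h - y) + N • h := by abel
      rw [this]
      exact AddSubgroup.add_mem _ (AddSubgroup.mem_sup_left (S.neg_mem hq')) (AddSubgroup.mem_sup_right ⟨h, hh, rfl⟩)

/-- On a finite abelian group of exponent `e`, multiplication by `N` is onto iff `gcd(N, e) = 1`: if a prime `p ∣ gcd(N, e)`, minimality of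
the exponent gives `x` with `(e/p)·x ≠ 0`, an element killed by `p`, hence by `N`, contradicting injectivity (= surjectivity on a finite set);
conversely `aN + be = 1` gives `q = N·(a q)`. [cite: AdkinsWeintraub1992, Ch. 3 §7 Thm. (7.1) and Rem. (7.10)] -/
private theorem nsmul_surjective_iff_coprime_exponent₄₉ {Q : Type*} [AddCommGroup Q] [Finite Q] (N : ℕ) :
    Surjective (fun q : Q ↦ N • q) ↔ Nat.Coprime N (AddMonoid.exponent Q) := by
  constructor
  · intro hsurj
    have hinj : Injective (fun q : Q ↦ N • q) := Finite.injective_iff_surjective.2 hsurj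
    by_contra hcop
    obtain ⟨p, hp, hpdvd⟩ := Nat.exists_prime_and_dvd hcop
    have hpN : p ∣ N := (Nat.dvd_gcd_iff.1 hpdvd).1
    obtain ⟨e', he'⟩ := (Nat.dvd_gcd_iff.1 hpdvd).2
    have he'pos : 0 < e' := Nat.pos_of_ne_zero fun h0 ↦ AddMonoid.exponent_ne_zero_of_finite (by rw [he', h0, mul_zero])
    have he'lt : e' < AddMonoid.exponent Q := by
      rw [he']; exact lt_mul_left he'pos hp.one_lt
    obtain ⟨x, hx⟩ := AddMonoid.exponent_min e' he'pos he'lt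
    have hpx : p • (e' • x) = 0 := by rw [← mul_nsmul', ← he']; exact AddMonoid.exponent_nsmul_eq_zero x
    have hNx : N • (e' • x) = 0 := by
      obtain ⟨c, rfl⟩ := hpN
      rw [mul_comm, mul_nsmul', hpx, nsmul_zero]
    exact hx (hinj (hNx.trans (nsmul_zero N).symm))
  · intro hcop q
    obtain ⟨a, b, hab⟩ := Nat.isCoprime_iff_coprime.2 hcop
    refine ⟨a • q, ?_⟩
    show N • (a • q) = q
    have h1 : ((a * N + b * AddMonoid.exponent Q : ℤ)) • q = q := by rw [hab, one_zsmul]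
    rw [add_zsmul, mul_zsmul, mul_zsmul, natCast_zsmul, natCast_zsmul, AddMonoid.exponent_nsmul_eq_zero, zsmul_zero, add_zero] at h1
    rw [smul_comm]
    exact h1

/-- `S + N·H = H ⟺ gcd(N, e) = 1` when `H/(S ∩ H)` is finite of exponent `e` (`S ≤ H`). [cite: AdkinsWeintraub1992, Ch. 3 §7 Thm. (7.1) and Rem. (7.10)] -/
private theorem sup_map_nsmul_eq_iff_coprime₄₉ (hSH : S ≤ H) [Finite (↥H ⧸ S.addSubgroupOf H)] {e : ℕ}
    (he : AddMonoid.exponent (↥H ⧸ S.addSubgroupOf H) = e) (N : ℕ) : S ⊔ H.map (nsmulAddMonoidHom N) = H ↔ Nat.Coprime N e := by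
  rw [sup_map_nsmul_eq_iff_nsmul_surjective₄₉ hSH, nsmul_surjective_iff_coprime_exponent₄₉, he]

/-- A group admitting an isomorphism with `⊕_x ℤ/n_x` (`n_x > 0`) is finite. [folklore] -/
private theorem finite_of_nonempty_addEquiv_pi_zmod₄₉ {Q : Type*} [AddCommGroup Q] {κ : Type*} [Fintype κ] {n : κ → ℕ}
    (hn : ∀ x, 0 < n x) (he : Nonempty (Q ≃+ ((x : κ) → ZMod (n x)))) : Finite Q := by
  obtain ⟨e⟩ := he
  haveI : ∀ x, NeZero (n x) := fun x ↦ ⟨(hn x).ne'⟩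
  exact Finite.of_equiv _ e.toEquiv.symm

end Generic

section ModN

variable {ι : Type*} [Fintype ι] [DecidableEq ι] {E : Type*} [NormedAddCommGroup E] [NormedSpace ℂ E]
  (Φ : (ι → ℝ) ≃L[ℝ] E) {j : ℕ} {e₀ : Fin (j + 2) ⊕ Fin (j + 2) ≃ ι} {η : E [⋀^Fin 2]→L[ℝ] ℝ} {d : Fin (j + 2) → ℕ}

/-! ## §1 Degree one: `γ_{g−1} ∧ H¹(X, ℤ) + N·H^{2g−1}(X, ℤ) = H^{2g−1}(X, ℤ) ⟺ gcd(N, d_g/d₁) = 1` -/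

/-- **Hard Lefschetz in degree one with the minimal class, modulo `N`.** Let `η` be a Riemann form of type `(d₁, …, d_g)` on `X = E/Φ(ℤ^ι)`
with a symplectic enumeration (`g = j + 2`) and `m = γ_{g−1}` (`θ^{∧(g−1)} = ((g−1)!·d₁⋯d_{g−1})·m`). Then
**`γ_{g−1} ∧ H¹(X, ℤ) + N·H^{2g−1}(X, ℤ) = H^{2g−1}(X, ℤ) ⟺ gcd(N, d_g/d₁) = 1`** — the cokernel is finite of exponent `d_g/d₁` (g41-#5) and
`N` acts invertibly on it iff `gcd(N, d_g/d₁) = 1`. [cite: Lange2023AbelianVarietiesComplex, §5.4.1 Thm. 5.4.1 and (5.22) (PDF p. 275); §1.5.1 (PDF p. 51)] [cite: VoisinHodgeI2002, §7.1.2 (PDF p. 134 L31); §7.2.2 (PDF p. 142 L10)] [cite: AdkinsWeintraub1992, Ch. 3 §7 Thm. (7.1) and Rem. (7.10)] -/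
theorem IsSymplecticEnum.map_wedge_integralForms_one_sup_map_nsmul_eq_iff_coprime_of_eq_content_smul (h : IsSymplecticEnum Φ e₀ η d)
    (hη : IsRiemannForm Φ η) (hle₁ : j + 1 ≤ j + 2) {m : E [⋀^Fin (2 * (j + 1))]→L[ℝ] ℂ}
    (hm : wedgePow (ofRealForm η) (j + 1) = (((j + 1).factorial * ∏ i : Fin (j + 1), d (Fin.castLE hle₁ i) : ℕ) : ℂ) • m) (N : ℕ) :
    (integralForms Φ 1).map (AddMonoidHom.mk'
        (fun x : E [⋀^Fin 1]→L[ℝ] ℂ ↦ (m.wedge x : E [⋀^Fin (2 * j + 3)]→L[ℝ] ℂ)) (ContinuousAlternatingMap.wedge_add_right _)) ⊔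
      (integralForms Φ (2 * j + 3)).map (nsmulAddMonoidHom N) = integralForms Φ (2 * j + 3) ↔
      Nat.Coprime N (d (Fin.last (j + 1)) / d 0) := by
  have hmZ : m ∈ integralForms Φ (2 * (j + 1)) := h.mem_integralForms_of_wedgePow_eq_content_smul Φ hη hle₁ hm
  have hSH : (integralForms Φ 1).map (AddMonoidHom.mk'
      (fun x : E [⋀^Fin 1]→L[ℝ] ℂ ↦ (m.wedge x : E [⋀^Fin (2 * j + 3)]→L[ℝ] ℂ)) (ContinuousAlternatingMap.wedge_add_right _)) ≤
      integralForms Φ (2 * j + 3) := by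
    rintro _ ⟨x, hx, rfl⟩
    exact wedge_mem_integralForms Φ hmZ hx
  haveI := finite_of_nonempty_addEquiv_pi_zmod₄₉
    (fun x ↦ Nat.div_pos (Nat.le_of_dvd (h.pos hη _) (h.dvd _ _ (Fin.le_last _))) (h.pos hη _))
    (h.nonempty_addEquiv_quotient_map_wedge_integralForms_one_of_eq_content_smul Φ hη hle₁ hm)
  exact sup_map_nsmul_eq_iff_coprime₄₉ hSH (h.exponent_quotient_map_wedge_integralForms_one_of_eq_content_smul Φ hη hle₁ hm) N

/-- **Prime form: `γ_{g−1} ∧ H¹(X, ℤ) + p·H^{2g−1}(X, ℤ) = H^{2g−1}(X, ℤ) ⟺ p ∤ d_g/d₁`** — the minimal class maps `H¹(X, ℤ/p)` onto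
`H^{2g−1}(X, ℤ/p)` exactly for the primes not dividing `d_g/d₁` (`g = j + 2`). [cite: Lange2023AbelianVarietiesComplex, §5.4.1 Thm. 5.4.1 and (5.22) (PDF p. 275); §1.5.1 (PDF p. 51)] [cite: VoisinHodgeI2002, §7.1.2 (PDF p. 134 L31)] -/
theorem IsSymplecticEnum.map_wedge_integralForms_one_sup_map_nsmul_eq_iff_not_dvd_of_eq_content_smul (h : IsSymplecticEnum Φ e₀ η d)
    (hη : IsRiemannForm Φ η) (hle₁ : j + 1 ≤ j + 2) {m : E [⋀^Fin (2 * (j + 1))]→L[ℝ] ℂ}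
    (hm : wedgePow (ofRealForm η) (j + 1) = (((j + 1).factorial * ∏ i : Fin (j + 1), d (Fin.castLE hle₁ i) : ℕ) : ℂ) • m)
    {p : ℕ} (hp : p.Prime) :
    (integralForms Φ 1).map (AddMonoidHom.mk'
        (fun x : E [⋀^Fin 1]→L[ℝ] ℂ ↦ (m.wedge x : E [⋀^Fin (2 * j + 3)]→L[ℝ] ℂ)) (ContinuousAlternatingMap.wedge_add_right _)) ⊔
      (integralForms Φ (2 * j + 3)).map (nsmulAddMonoidHom p) = integralForms Φ (2 * j + 3) ↔
      ¬p ∣ d (Fin.last (j + 1)) / d 0 := by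
  rw [h.map_wedge_integralForms_one_sup_map_nsmul_eq_iff_coprime_of_eq_content_smul Φ hη hle₁ hm, hp.coprime_iff_not_dvd]

/-! ## §2 The co-Lefschetz map on `H³`: `γ_{g−2} ∧ H³(X, ℤ) + N·H^{2g−1}(X, ℤ) = H^{2g−1}(X, ℤ) ⟺ gcd(N, d_{g−1}/d₁) = 1` -/

/-- **`γ_{g−2} ∧ H³(X, ℤ) + N·H^{2g−1}(X, ℤ) = H^{2g−1}(X, ℤ) ⟺ gcd(N, d_{g−1}/d₁) = 1`** (`g = j + 2`, `θ^{∧(g−2)} = ((g−2)!·d₁⋯d_{g−2})·γ`;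
the cokernel has exponent `d_{g−1}/d₁`, g41-#5). [cite: Lange2023AbelianVarietiesComplex, §5.4.1 Thm. 5.4.1 and (5.22) (PDF p. 275); §2.5.3 Thm. 2.5.16 (PDF p. 135); §1.5.1 (PDF p. 51)] [cite: VoisinHodgeI2002, §7.1.2 (PDF p. 134 L31)] [cite: AdkinsWeintraub1992, Ch. 3 §7 Thm. (7.1) and Rem. (7.10)] -/
theorem IsSymplecticEnum.map_wedge_integralForms_three_sup_map_nsmul_eq_iff_coprime_of_eq_content_smul (h : IsSymplecticEnum Φ e₀ η d)
    (hη : IsRiemannForm Φ η) (hle₂ : j ≤ j + 2) {γ : E [⋀^Fin (2 * j)]→L[ℝ] ℂ}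
    (hγ : wedgePow (ofRealForm η) j = ((j.factorial * ∏ i : Fin j, d (Fin.castLE hle₂ i) : ℕ) : ℂ) • γ) (N : ℕ) :
    (integralForms Φ 3).map (AddMonoidHom.mk'
        (fun x : E [⋀^Fin 3]→L[ℝ] ℂ ↦ γ.wedge x) (ContinuousAlternatingMap.wedge_add_right _)) ⊔
      (integralForms Φ (2 * j + 3)).map (nsmulAddMonoidHom N) = integralForms Φ (2 * j + 3) ↔
      Nat.Coprime N (d (Fin.last j).castSucc / d 0) := by
  have hγZ : γ ∈ integralForms Φ (2 * j) := h.mem_integralForms_of_wedgePow_eq_content_smul Φ hη hle₂ hγ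
  have hSH : (integralForms Φ 3).map (AddMonoidHom.mk'
      (fun x : E [⋀^Fin 3]→L[ℝ] ℂ ↦ γ.wedge x) (ContinuousAlternatingMap.wedge_add_right _)) ≤ integralForms Φ (2 * j + 3) := by
    rintro _ ⟨x, hx, rfl⟩
    exact wedge_mem_integralForms Φ hγZ hx
  haveI := finite_of_nonempty_addEquiv_pi_zmod₄₉
    (fun x ↦ Nat.div_pos (Nat.le_of_dvd (h.pos hη _) (by
      split_ifs with hx
      · exact dvd_rfl
      · exact h.dvd _ _ (Fin.le_castSucc_iff.2 ((Fin.le_last _).lt_of_ne hx)))) (h.pos hη _))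
    (h.nonempty_addEquiv_quotient_map_wedge_integralForms_three_of_eq_content_smul Φ hη hle₂ hγ)
  exact sup_map_nsmul_eq_iff_coprime₄₉ hSH (h.exponent_quotient_map_wedge_integralForms_three_of_eq_content_smul Φ hη hle₂ hγ) N

/-- **Prime form: `γ_{g−2} ∧ H³(X, ℤ) + p·H^{2g−1}(X, ℤ) = H^{2g−1}(X, ℤ) ⟺ p ∤ d_{g−1}/d₁`** (`g = j + 2`).
[cite: Lange2023AbelianVarietiesComplex, §5.4.1 Thm. 5.4.1 and (5.22) (PDF p. 275); §1.5.1 (PDF p. 51)] [cite: VoisinHodgeI2002, §7.1.2 (PDF p. 134 L31)] -/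
theorem IsSymplecticEnum.map_wedge_integralForms_three_sup_map_nsmul_eq_iff_not_dvd_of_eq_content_smul (h : IsSymplecticEnum Φ e₀ η d)
    (hη : IsRiemannForm Φ η) (hle₂ : j ≤ j + 2) {γ : E [⋀^Fin (2 * j)]→L[ℝ] ℂ}
    (hγ : wedgePow (ofRealForm η) j = ((j.factorial * ∏ i : Fin j, d (Fin.castLE hle₂ i) : ℕ) : ℂ) • γ) {p : ℕ} (hp : p.Prime) :
    (integralForms Φ 3).map (AddMonoidHom.mk'
        (fun x : E [⋀^Fin 3]→L[ℝ] ℂ ↦ γ.wedge x) (ContinuousAlternatingMap.wedge_add_right _)) ⊔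
      (integralForms Φ (2 * j + 3)).map (nsmulAddMonoidHom p) = integralForms Φ (2 * j + 3) ↔
      ¬p ∣ d (Fin.last j).castSucc / d 0 := by
  rw [h.map_wedge_integralForms_three_sup_map_nsmul_eq_iff_coprime_of_eq_content_smul Φ hη hle₂ hγ, hp.coprime_iff_not_dvd]

/-! ## §3 Basis-free forms: any presentation of a polarised torus of type `(d₁, …, d_g)` -/

/-- **Any presentation: `γ_{g−1} ∧ H¹(X, ℤ) + N·H^{2g−1}(X, ℤ) = H^{2g−1}(X, ℤ) ⟺ gcd(N, d_g/d₁) = 1`** (`g = j + 2`).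
[cite: Lange2023AbelianVarietiesComplex, §5.4.1 Thm. 5.4.1 and (5.22) (PDF p. 275); §1.5.1 (PDF p. 51)] [cite: VoisinHodgeI2002, §7.2.2 (PDF p. 142 L10)] -/
theorem IsPolarizationType.map_wedge_integralForms_one_sup_map_nsmul_eq_iff_coprime_of_eq_content_smul {Φ : (ι → ℝ) ≃L[ℝ] E}
    (hd : IsPolarizationType Φ η d) (hη : IsRiemannForm Φ η) (hle₁ : j + 1 ≤ j + 2) {m : E [⋀^Fin (2 * (j + 1))]→L[ℝ] ℂ}
    (hm : wedgePow (ofRealForm η) (j + 1) = (((j + 1).factorial * ∏ i : Fin (j + 1), d (Fin.castLE hle₁ i) : ℕ) : ℂ) • m) (N : ℕ) :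
    (integralForms Φ 1).map (AddMonoidHom.mk'
        (fun x : E [⋀^Fin 1]→L[ℝ] ℂ ↦ (m.wedge x : E [⋀^Fin (2 * j + 3)]→L[ℝ] ℂ)) (ContinuousAlternatingMap.wedge_add_right _)) ⊔
      (integralForms Φ (2 * j + 3)).map (nsmulAddMonoidHom N) = integralForms Φ (2 * j + 3) ↔
      Nat.Coprime N (d (Fin.last (j + 1)) / d 0) := by
  obtain ⟨Φ', hΛ, hs⟩ := hd.exists_isSymplecticEnum Φ
  rw [integralForms_eq_of_range_latticeVec_eq hΛ.symm 1, integralForms_eq_of_range_latticeVec_eq hΛ.symm (2 * j + 3)]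
  exact hs.map_wedge_integralForms_one_sup_map_nsmul_eq_iff_coprime_of_eq_content_smul Φ' (hη.of_range_latticeVec_subset hΛ.le) hle₁ hm N

/-- **Any presentation: `γ_{g−2} ∧ H³(X, ℤ) + N·H^{2g−1}(X, ℤ) = H^{2g−1}(X, ℤ) ⟺ gcd(N, d_{g−1}/d₁) = 1`** (`g = j + 2`).
[cite: Lange2023AbelianVarietiesComplex, §5.4.1 Thm. 5.4.1 and (5.22) (PDF p. 275); §1.5.1 (PDF p. 51)] [cite: VoisinHodgeI2002, §7.1.2 (PDF p. 134 L31)] -/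
theorem IsPolarizationType.map_wedge_integralForms_three_sup_map_nsmul_eq_iff_coprime_of_eq_content_smul {Φ : (ι → ℝ) ≃L[ℝ] E}
    (hd : IsPolarizationType Φ η d) (hη : IsRiemannForm Φ η) (hle₂ : j ≤ j + 2) {γ : E [⋀^Fin (2 * j)]→L[ℝ] ℂ}
    (hγ : wedgePow (ofRealForm η) j = ((j.factorial * ∏ i : Fin j, d (Fin.castLE hle₂ i) : ℕ) : ℂ) • γ) (N : ℕ) :
    (integralForms Φ 3).map (AddMonoidHom.mk'
        (fun x : E [⋀^Fin 3]→L[ℝ] ℂ ↦ γ.wedge x) (ContinuousAlternatingMap.wedge_add_right _)) ⊔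
      (integralForms Φ (2 * j + 3)).map (nsmulAddMonoidHom N) = integralForms Φ (2 * j + 3) ↔
      Nat.Coprime N (d (Fin.last j).castSucc / d 0) := by
  obtain ⟨Φ', hΛ, hs⟩ := hd.exists_isSymplecticEnum Φ
  rw [integralForms_eq_of_range_latticeVec_eq hΛ.symm 3, integralForms_eq_of_range_latticeVec_eq hΛ.symm (2 * j + 3)]
  exact hs.map_wedge_integralForms_three_sup_map_nsmul_eq_iff_coprime_of_eq_content_smul Φ' (hη.of_range_latticeVec_subset hΛ.le) hle₂ hγ N

/-- **Existence form, degree one**: any polarised torus of type `(d₁, …, d_g)` (`g = j + 2`) carries the integral minimal class `γ_{g−1}` with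
`γ_{g−1} ∧ H¹(X, ℤ) + N·H^{2g−1}(X, ℤ) = H^{2g−1}(X, ℤ) ⟺ gcd(N, d_g/d₁) = 1` for every `N`.
[cite: Lange2023AbelianVarietiesComplex, §2.5.3 Thm. 2.5.16 and Cor. 2.5.17 (PDF p. 135); §5.4.1 (5.22) (PDF p. 275); §1.5.1 (PDF p. 51)] [cite: VoisinHodgeI2002, §7.2.2 (PDF p. 142 L10)] -/
theorem IsPolarizationType.exists_minimalClass_map_wedge_integralForms_one_sup_map_nsmul_eq_iff_coprime {Φ : (ι → ℝ) ≃L[ℝ] E}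
    (hd : IsPolarizationType Φ η d) (hη : IsRiemannForm Φ η) (hle₁ : j + 1 ≤ j + 2) :
    ∃ m ∈ integralForms Φ (2 * (j + 1)),
      wedgePow (ofRealForm η) (j + 1) = (((j + 1).factorial * ∏ i : Fin (j + 1), d (Fin.castLE hle₁ i) : ℕ) : ℂ) • m ∧
      ∀ N : ℕ, (integralForms Φ 1).map (AddMonoidHom.mk'
          (fun x : E [⋀^Fin 1]→L[ℝ] ℂ ↦ (m.wedge x : E [⋀^Fin (2 * j + 3)]→L[ℝ] ℂ)) (ContinuousAlternatingMap.wedge_add_right _)) ⊔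
        (integralForms Φ (2 * j + 3)).map (nsmulAddMonoidHom N) = integralForms Φ (2 * j + 3) ↔ Nat.Coprime N (d (Fin.last (j + 1)) / d 0) := by
  obtain ⟨m, hmZ, hm⟩ := hd.exists_mem_integralForms_wedgePow_eq_content_smul hle₁
  exact ⟨m, hmZ, hm, fun N ↦ hd.map_wedge_integralForms_one_sup_map_nsmul_eq_iff_coprime_of_eq_content_smul hη hle₁ hm N⟩

/-- **Existence form, degree three**: the integral minimal class `γ_{g−2}` with `γ_{g−2} ∧ H³(X, ℤ) + N·H^{2g−1}(X, ℤ) = H^{2g−1}(X, ℤ) ⟺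
gcd(N, d_{g−1}/d₁) = 1` (`g = j + 2`). [cite: Lange2023AbelianVarietiesComplex, §2.5.3 Thm. 2.5.16 and Cor. 2.5.17 (PDF p. 135); §5.4.1 (5.22) (PDF p. 275); §1.5.1 (PDF p. 51)] [cite: VoisinHodgeI2002, §7.1.2 (PDF p. 134 L31)] -/
theorem IsPolarizationType.exists_minimalClass_map_wedge_integralForms_three_sup_map_nsmul_eq_iff_coprime {Φ : (ι → ℝ) ≃L[ℝ] E}
    (hd : IsPolarizationType Φ η d) (hη : IsRiemannForm Φ η) (hle₂ : j ≤ j + 2) :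
    ∃ γ ∈ integralForms Φ (2 * j), wedgePow (ofRealForm η) j = ((j.factorial * ∏ i : Fin j, d (Fin.castLE hle₂ i) : ℕ) : ℂ) • γ ∧
      ∀ N : ℕ, (integralForms Φ 3).map (AddMonoidHom.mk'
          (fun x : E [⋀^Fin 3]→L[ℝ] ℂ ↦ γ.wedge x) (ContinuousAlternatingMap.wedge_add_right _)) ⊔
        (integralForms Φ (2 * j + 3)).map (nsmulAddMonoidHom N) = integralForms Φ (2 * j + 3) ↔ Nat.Coprime N (d (Fin.last j).castSucc / d 0) := by
  obtain ⟨γ, hγZ, hγ⟩ := hd.exists_mem_integralForms_wedgePow_eq_content_smul hle₂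
  exact ⟨γ, hγZ, hγ, fun N ↦ hd.map_wedge_integralForms_three_sup_map_nsmul_eq_iff_coprime_of_eq_content_smul hη hle₂ hγ N⟩

end ModN

end Literature.Geometry.Kaehler.ComplexTorus
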